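import Summits.HodgeConjecture.CorCM.Census.BlockParityTransfer
import Summits.HodgeConjecture.CorCM.Census.BlockParityBurnsideCyclic
import Summits.HodgeConjecture.CorCM.FaceBasisFloor
import Summits.HodgeConjecture.CorCM.FaceCensusOrbitTransport
import HarnessLib

/-!
# The face-parity FLOOR: a set of faces of a Galois CM field whose Weil characters generate those of all faces has at least
# `β − 1 − δ` members (`β` = number of blocks of abstract CM types, `δ ∈ {0,1}` the weight-parity invariant)

COR-CM (cell `pub-hodgecm2`), count-neutral kernel combinatorics by the binder seat b09 (gen 28; lane BLOCK-PARITY-FLOOR),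
part IV: the intrinsic form, for a Galois CM field `F`, of the block-parity law of `Census/BlockParityLaw.lean` (I),
`Census/BlockParityRelations.lean` (II), `Census/BlockParityExactRank.lean` (III), `Census/BlockParityTransfer.lean` (V),
`Census/BlockParityBurnside.lean` (VI) and `Census/BlockParityBurnsideCyclic.lean` (VII); sibling of the rank floor
`CorCM/FaceBasisFloor.two_pow_le_of_hgen` (b09 gen 27).  Theorems only; no `decide`, no certificate, no named fact, no `sorry`;
`Interfaces.lean` (C1), every E term, B01, `Transposition/*` untouched.  HONEST FRAMING: `HC_CM` is NOT proved, here or anywhere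
in the tree; nothing here is a period.  T5: n/a-class — the one Prop binder is the generation binder `hgen(𝒮, σ₀)` of INT2-GEN
(`CorCM/FacePeriodsGeneratingSet.lean`), inhabited by `FaceBasis.basisFace_hgen`; no named-fact / conjecture-def binder;
checker: self (prover-pub-hodgecm2-b09-g28-0), 2026-08-22.

SETTING.  `F` a Galois CM field, `G = GalT F` (the Galois translates of `Hom(F, ℂ)`), `c = conjT` (central: `FaceBasis.conjT_comm`),
abstract CM types `CMF (GalT F) conjT`, and the `σ`-reads `weightRel g.corner (fun _ ↦ {σ})` / `lefChar g.corner (fun _ ↦ {σ})` of the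
rank-four faces `g : Face F` (`CorCM/CM/LefschetzChar1.lean`).
* §1 DICTIONARY to part I: the conjugate type is the base change along `conjT` (`barCM_eq_rt`), so the block parities kill `pairRel`
  (`par_eq_zero_of_mem_pairRel`); reading a face at `σ` instead of `σ₀` is the base change along `translate σ₀ σ`
  (`weightRel_corner_eq_mapDomain_rt`, from seat b23's `FaceCensus.mapDomain_weightRel_corner`).
* §2 Under the generation binder `hgen(𝒮, σ₀)` every abstract face relation `gface Φ t t'` lies in
  `pairRel + ℤ[G]·{σ₀-reads of 𝒮}` (`gfaceSet_subset_of_hgen`, via `faceOfG` / `lefChar_corner_faceOfG` of `CM/LefschetzChar2.lean`).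
* §3 **THE FACE-PARITY FLOOR** (`card_block_le_card_add_of_hgen`): for every finite `𝒮 ⊆ Face F` with `hgen(𝒮, σ₀)` and every base
  type `T₀`:  **`β(F) ≤ |𝒮| + 1 + δ(F)`**, where `β(F) = Fintype.card (Block conjT)` is the number of blocks (= base-change orbits of
  abstract CM types = isogeny classes of simple CM abelian varieties whose CM is split by `F` [cite: Milne1999, Prop. 2.1, p. 54];
  by Burnside `(1/|G|) Σ_{g : c ∉ ⟨g⟩} 2^{|G|/(2·ord g)}`) and `δ(F) = wdelta conjT T₀ ∈ {0,1}` is `1` iff the weight parity is constant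
  on blocks (independent of `T₀`: III `wdelta_eq_wdelta`); hence always **`|𝒮| ≥ β(F) − 2`** (`card_block_le_card_add_two_of_hgen`),
  and `|𝒮| ≥ β(F) − 1` when the weight parity moves (`card_block_le_card_add_one_of_hgen`).  With `FaceBasisFloor` and
  `FaceBasisGeneratingSet`: `max(β − 1 − δ, ⌈(2^{n−1} − n)/n⌉) ≤ min |𝒮| ≤ 2^{n−1} − n` for EVERY Galois CM field of degree `2n`, no
  census.  Numerically (part II docstring) the parity floor equals André-3's `μ` on every row of orders `6, 10, 12, 14, 18, 20` and on
  most rows of orders `8, 16`; it is the sharper of the two floors whenever `G` has small base-change orbits (`ℤ/18: 29 > 28`,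
  `ℤ/2×ℤ/10: 54 > 51`, `D₂₀: 66 > 51`).
* §4 **`δ(F)` by the transfer** (part V): `δ(F) = 1 ⟺ Pⁿ = 1` for every Galois translate `P` (`n = [F:ℚ]/2`;
  `wdelta_eq_one_iff_forall_pow_eq_one`); hence **`β(F) ≤ |𝒮| + 1` whenever some `P ∈ GalT F` has `Pⁿ ≠ 1`**
  (`card_block_le_card_add_one_of_hgen_of_pow_ne_one`), in particular for every CM field with CYCLIC `GalT F ≅ Gal(F/ℚ)`
  (`card_block_le_card_add_one_of_hgen_of_isCyclic`): `|𝒮| ≥ β(F) − 1`, André-3's exact `μ` on `ℤ/6 … ℤ/22`.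
* §5 **`β(F)` by Burnside** (parts VI–VII): `β(F)·[F:ℚ] = Σ_{P ∈ GalT F} [conjT ∉ ⟨P⟩]·2^{[F:ℚ]/ord P/2}` (`card_block_mul_finrank`),
  and for cyclic `GalT F`: `β(F)·[F:ℚ] = Σ_{d ∣ [F:ℚ], d odd} φ(d)·2^{[F:ℚ]/2/d}` (`card_block_mul_finrank_of_isCyclic`) — so for a cyclic
  CM field of degree `2m` every `hgen` face set has at least `(1/2m)Σ_{d | m, d odd} φ(d) 2^{m/d} − 1` members (`1, 1, 3, 5, 9, 15, 29,
  51, 93, 171, 315` for `2m = 6 … 26`), census-free.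

## References
* [Pohlmann1968] H. Pohlmann, Algebraic cycles on abelian varieties of complex multiplication type, Ann. of Math. 88 (1968), Thm 1.
* [Milne1999] J. S. Milne, Lefschetz motives and the Tate conjecture, Compositio Math. 117 (1999), Prop. 2.1, p. 54.
* [Milne1999LefschetzClasses] J. S. Milne, Lefschetz classes on abelian varieties, Duke Math. J. 96 (1999), Thm. 3.2.
-/

noncomputable section

open NumberField NumberField.ComplexEmbedding

namespace Summit.HodgeConjecture.CorCM.FaceParity

open Literature.AlgebraicGeometry.Motives (CMType)
open Summit.HodgeConjecture.CorCM.Prior.AllgGroup.RfwfAllgGroup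
open Summit.HodgeConjecture.CorCM.Census.BlockParity

variable {F : Type} [Field F] [NumberField F]

/-! ## §1 Dictionary: conjugation and reads as base changes -/

/-- **The conjugate abstract type is the base change along `conjT`**: `Ψ̄ = Ψ·conjT`. [folklore] -/
theorem barCM_eq_rt [IsCMField F] [IsGalois ℚ F] (Ψ : CMF (GalT F) conjT) : barCM Ψ = rt conjT conjT Ψ := by
  apply Subtype.ext
  rw [rt_self_val conjT (fun P => FaceBasis.conjT_comm P) Ψ]
  rfl

/-- **The block parities kill the pair relations** of a Galois CM field. [folklore] -/
theorem par_eq_zero_of_mem_pairRel [IsCMField F] [IsGalois ℚ F] {y : CMF (GalT F) conjT →₀ ℤ} (hy : y ∈ pairRel) :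
    par (conjT : GalT F) y = 0 := by
  have hle : (pairRel : Submodule ℤ (CMF (GalT F) conjT →₀ ℤ)) ≤ LinearMap.ker (par (conjT : GalT F)) := by
    unfold pairRel
    rw [Submodule.span_le]
    rintro _ ⟨Ψ, rfl⟩
    rw [SetLike.mem_coe, LinearMap.mem_ker, barCM_eq_rt, par_pair]
  exact LinearMap.mem_ker.mp (hle hy)

/-- Base change of abstract types along `Q` in seat b23's spelling is `rt conjT Q`. [folklore] -/
theorem pullType_pushType_eq_rt [IsGalois ℚ F] (σ₀ : F →+* ℂ) (Q : GalT F) (Ψ : CMF (GalT F) conjT) :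
    pullType (pushType σ₀ Ψ) (Q.1 σ₀) = rt conjT Q Ψ := by
  apply Subtype.ext; ext P
  rw [FaceCensus.mem_pullType_pushType, mem_rt]

/-- **Reading a face at `σ` is the base change, along `translate σ₀ σ`, of its read at `σ₀`.** [folklore] -/
theorem weightRel_corner_eq_mapDomain_rt [IsGalois ℚ F] (g : Face F) (σ₀ σ : F →+* ℂ) :
    weightRel g.corner (fun _ => ({σ} : Finset (F →+* ℂ))) =
      Finsupp.mapDomain (rt conjT (translate σ₀ σ)) (weightRel g.corner (fun _ => ({σ₀} : Finset (F →+* ℂ)))) := by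
  have hf : (fun Ψ : CMF (GalT F) conjT => pullType (pushType σ₀ Ψ) ((translate σ₀ σ).1 σ₀)) = rt conjT (translate σ₀ σ) :=
    funext fun Ψ => pullType_pushType_eq_rt σ₀ (translate σ₀ σ) Ψ
  have h := FaceCensus.mapDomain_weightRel_corner σ₀ (translate σ₀ σ) g σ₀
  rw [hf, translate_apply_self] at h
  exact h.symm

/-! ## §2 Under `hgen(𝒮, σ₀)` the abstract faces lie in `pairRel + ℤ[G]·(σ₀-reads of 𝒮)` -/

/-- The `σ₀`-reads of a set of faces, as a family in `ℤ[types]`. [folklore] -/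
theorem card_image_reads_le (𝒮 : Finset (Face F)) (σ₀ : F →+* ℂ) :
    (𝒮.image fun g : Face F => weightRel g.corner (fun _ => ({σ₀} : Finset (F →+* ℂ)))).card ≤ 𝒮.card :=
  Finset.card_image_le

/-- **Every abstract face relation lies in the generating module** `pairRel ⊔ span ℤ (translates of the σ₀-reads of 𝒮)` when
`hgen(𝒮, σ₀)` holds. [folklore] -/
theorem gfaceSet_subset_of_hgen [IsGalois ℚ F] (𝒮 : Finset (Face F)) (σ₀ : F →+* ℂ)
    (hgen : ∀ f : Face F, lefChar f.corner (fun _ => ({σ₀} : Finset (F →+* ℂ))) ∈ AddSubgroup.closure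
      {a : Asym F | ∃ g ∈ (𝒮 : Set (Face F)), ∃ σ : F →+* ℂ, a = lefChar g.corner (fun _ => ({σ} : Finset (F →+* ℂ)))}) :
    gfaceSet (GalT F) conjT conjT_mul_self ⊆
      ↑((pairRel : Submodule ℤ (CMF (GalT F) conjT →₀ ℤ)) ⊔ Submodule.span ℤ
        (translates conjT (𝒮.image fun g : Face F => weightRel g.corner (fun _ => ({σ₀} : Finset (F →+* ℂ)))))) := by
  set M : Submodule ℤ (CMF (GalT F) conjT →₀ ℤ) := pairRel ⊔ Submodule.span ℤ
    (translates conjT (𝒮.image fun g : Face F => weightRel g.corner (fun _ => ({σ₀} : Finset (F →+* ℂ))))) with hM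
  -- Step A: every read of a face of `𝒮` lies in `M`
  have hA : ∀ g ∈ 𝒮, ∀ σ : F →+* ℂ, weightRel g.corner (fun _ => ({σ} : Finset (F →+* ℂ))) ∈ M := by
    intro g hg σ
    rw [weightRel_corner_eq_mapDomain_rt g σ₀ σ]
    refine Submodule.mem_sup_right (Submodule.subset_span ⟨translate σ₀ σ, _, ?_, rfl⟩)
    exact Finset.mem_image_of_mem _ hg
  -- Step B: hence the closure of the characters lies in `abar M`
  have hB : AddSubgroup.closure {a : Asym F | ∃ g ∈ (𝒮 : Set (Face F)), ∃ σ : F →+* ℂ,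
      a = lefChar g.corner (fun _ => ({σ} : Finset (F →+* ℂ)))} ≤ (M.map abar).toAddSubgroup := by
    rw [AddSubgroup.closure_le]
    rintro _ ⟨g, hg, σ, rfl⟩
    rw [← abar_weightRel]
    exact Submodule.mem_map_of_mem (hA g hg σ)
  -- Step C: an abstract face is the `σ₀`-read of a geometric face, modulo pairs
  rintro _ ⟨Φ, t, t', ht', rfl⟩
  have h := hB (hgen (faceOfG σ₀ Φ t t' ht'))
  rw [lefChar_corner_faceOfG] at h
  obtain ⟨m, hm, hme⟩ := h
  have hdiff : gface conjT conjT_mul_self Φ t t' - m ∈ (pairRel : Submodule ℤ (CMF (GalT F) conjT →₀ ℤ)) := by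
    rw [← Submodule.ker_mkQ (pairRel : Submodule ℤ (CMF (GalT F) conjT →₀ ℤ)), LinearMap.mem_ker, map_sub]
    change abar (gface conjT conjT_mul_self Φ t t') - abar m = 0
    rw [hme, sub_self]
  have e : gface conjT conjT_mul_self Φ t t' = (gface conjT conjT_mul_self Φ t t' - m) + m := by abel
  rw [SetLike.mem_coe, e]
  exact Submodule.add_mem _ (Submodule.mem_sup_left hdiff) hm

/-! ## §3 The face-parity floor -/

/-- **THE FACE-PARITY FLOOR.**  For a Galois CM field `F`, ANY finite set `𝒮` of faces satisfying the generation binder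
`hgen(𝒮, σ₀)` of INT2-GEN and any base type `T₀`: `β(F) ≤ |𝒮| + 1 + δ(F)`, i.e. `|𝒮| ≥ β − 1 − δ` — no census, no
certificate, every degree and every Galois type. [folklore] -/
theorem card_block_le_card_add_of_hgen [IsCMField F] [IsGalois ℚ F] (𝒮 : Finset (Face F)) (σ₀ : F →+* ℂ)
    (T₀ : CMF (GalT F) conjT)
    (hgen : ∀ f : Face F, lefChar f.corner (fun _ => ({σ₀} : Finset (F →+* ℂ))) ∈ AddSubgroup.closure
      {a : Asym F | ∃ g ∈ (𝒮 : Set (Face F)), ∃ σ : F →+* ℂ, a = lefChar g.corner (fun _ => ({σ} : Finset (F →+* ℂ)))}) :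
    Fintype.card (Block (conjT : GalT F)) ≤ 𝒮.card + 1 + wdelta (conjT : GalT F) T₀ := by
  have h := card_block_le_card_add conjT conjT_mul_self T₀ _ pairRel (fun y hy => par_eq_zero_of_mem_pairRel hy)
    (gfaceSet_subset_of_hgen 𝒮 σ₀ hgen)
  have h2 := card_image_reads_le 𝒮 σ₀
  omega

/-- **Floor, `δ`-free form**: `β(F) ≤ |𝒮| + 2` for every `hgen(𝒮, σ₀)` set of faces. [folklore] -/
theorem card_block_le_card_add_two_of_hgen [IsCMField F] [IsGalois ℚ F] (𝒮 : Finset (Face F)) (σ₀ : F →+* ℂ)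
    (hgen : ∀ f : Face F, lefChar f.corner (fun _ => ({σ₀} : Finset (F →+* ℂ))) ∈ AddSubgroup.closure
      {a : Asym F | ∃ g ∈ (𝒮 : Set (Face F)), ∃ σ : F →+* ℂ, a = lefChar g.corner (fun _ => ({σ} : Finset (F →+* ℂ)))}) :
    Fintype.card (Block (conjT : GalT F)) ≤ 𝒮.card + 2 := by
  obtain ⟨T, hT⟩ := exists_isCMF (conjT : GalT F) conjT_mul_self conjT_ne_one
  have h := card_block_le_card_add_of_hgen 𝒮 σ₀ ⟨T, hT⟩ hgen
  have h1 := wdelta_le_one (conjT : GalT F) ⟨T, hT⟩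
  omega

/-- **Floor when the weight parity moves**: if some base change changes the weight parity, `β(F) ≤ |𝒮| + 1`. [folklore] -/
theorem card_block_le_card_add_one_of_hgen [IsCMField F] [IsGalois ℚ F] (𝒮 : Finset (Face F)) (σ₀ : F →+* ℂ)
    (T₀ : CMF (GalT F) conjT) (hmove : ¬ ∀ (Q : GalT F) (Ψ : CMF (GalT F) conjT), wpar conjT T₀ (rt conjT Q Ψ) = wpar conjT T₀ Ψ)
    (hgen : ∀ f : Face F, lefChar f.corner (fun _ => ({σ₀} : Finset (F →+* ℂ))) ∈ AddSubgroup.closure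
      {a : Asym F | ∃ g ∈ (𝒮 : Set (Face F)), ∃ σ : F →+* ℂ, a = lefChar g.corner (fun _ => ({σ} : Finset (F →+* ℂ)))}) :
    Fintype.card (Block (conjT : GalT F)) ≤ 𝒮.card + 1 := by
  have h := card_block_le_card_add_of_hgen 𝒮 σ₀ T₀ hgen
  rw [wdelta_eq_zero conjT hmove] at h
  omega

/-- **The exact strength of the parity method for `F`**: the block parities of the face lattice of `F` span exactly
`β(F) − 1 − δ(F)` dimensions over `𝔽₂`. [folklore] -/
theorem finrank_span_par_gfaceSet_add [IsCMField F] [IsGalois ℚ F] (T₀ : CMF (GalT F) conjT) :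
    Module.finrank (ZMod 2) (Submodule.span (ZMod 2) (par (conjT : GalT F) '' gfaceSet (GalT F) conjT conjT_mul_self)) + 1 +
      wdelta (conjT : GalT F) T₀ = Fintype.card (Block (conjT : GalT F)) :=
  Census.BlockParity.finrank_span_par_gfaceSet_add conjT conjT_mul_self T₀

/-! ## §4 `δ(F)` by the transfer: cyclic Galois groups and elements of order not dividing `n` -/

/-- **`δ(F) = 1 ⟺ Pⁿ = 1` for every Galois translate `P`** (`n = [F:ℚ]/2`): the transfer `GalT F → ⟨conjT⟩`. [folklore] -/
theorem wdelta_eq_one_iff_forall_pow_eq_one [IsCMField F] [IsGalois ℚ F] (T₀ : CMF (GalT F) conjT) :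
    wdelta (conjT : GalT F) T₀ = 1 ↔ ∀ P : GalT F, P ^ (Module.finrank ℚ F / 2) = 1 := by
  rw [← FaceCensus.card_galT (F := F)]
  exact wdelta_eq_one_iff conjT conjT_mul_self conjT_ne_one (fun P => FaceBasis.conjT_comm P) T₀

/-- **Floor `β(F) ≤ |𝒮| + 1` when some Galois translate has `Pⁿ ≠ 1`.** [folklore] -/
theorem card_block_le_card_add_one_of_hgen_of_pow_ne_one [IsCMField F] [IsGalois ℚ F] (𝒮 : Finset (Face F))
    (σ₀ : F →+* ℂ) {P : GalT F} (hP : P ^ (Module.finrank ℚ F / 2) ≠ 1)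
    (hgen : ∀ f : Face F, lefChar f.corner (fun _ => ({σ₀} : Finset (F →+* ℂ))) ∈ AddSubgroup.closure
      {a : Asym F | ∃ g ∈ (𝒮 : Set (Face F)), ∃ σ : F →+* ℂ, a = lefChar g.corner (fun _ => ({σ} : Finset (F →+* ℂ)))}) :
    Fintype.card (Block (conjT : GalT F)) ≤ 𝒮.card + 1 := by
  obtain ⟨T, hT⟩ := exists_isCMF (conjT : GalT F) conjT_mul_self conjT_ne_one
  have h := card_block_le_card_add_of_hgen 𝒮 σ₀ ⟨T, hT⟩ hgen
  rw [← FaceCensus.card_galT (F := F)] at hP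
  rw [wdelta_eq_zero_of_pow_ne_one conjT conjT_mul_self conjT_ne_one (fun P => FaceBasis.conjT_comm P) ⟨T, hT⟩ hP] at h
  omega

/-- **Floor `β(F) ≤ |𝒮| + 1` for CYCLIC `GalT F`** (every cyclic Galois CM field: `ℚ(ζ_p)`, `ℚ(ζ_{p^k})`, …): with André-3's
atlas, `|𝒮| ≥ β − 1` is the exact minimum on `ℤ/6, …, ℤ/22`. [folklore] -/
theorem card_block_le_card_add_one_of_hgen_of_isCyclic [IsCMField F] [IsGalois ℚ F] [IsCyclic (GalT F)]
    (𝒮 : Finset (Face F)) (σ₀ : F →+* ℂ)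
    (hgen : ∀ f : Face F, lefChar f.corner (fun _ => ({σ₀} : Finset (F →+* ℂ))) ∈ AddSubgroup.closure
      {a : Asym F | ∃ g ∈ (𝒮 : Set (Face F)), ∃ σ : F →+* ℂ, a = lefChar g.corner (fun _ => ({σ} : Finset (F →+* ℂ)))}) :
    Fintype.card (Block (conjT : GalT F)) ≤ 𝒮.card + 1 := by
  obtain ⟨T, hT⟩ := exists_isCMF (conjT : GalT F) conjT_mul_self conjT_ne_one
  have h := card_block_le_card_add_of_hgen 𝒮 σ₀ ⟨T, hT⟩ hgen
  rw [wdelta_eq_zero_of_isCyclic conjT conjT_mul_self conjT_ne_one (fun P => FaceBasis.conjT_comm P) ⟨T, hT⟩] at h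
  omega

/-! ## §5 `β(F)` by Burnside -/

/-- **The number of blocks of a Galois CM field by Burnside**: `β(F)·[F:ℚ] = Σ_{P ∈ GalT F} [conjT ∉ ⟨P⟩]·2^{[F:ℚ]/ord P/2}`.
[folklore] -/
theorem card_block_mul_finrank [IsCMField F] [IsGalois ℚ F] :
    Fintype.card (Block (conjT : GalT F)) * Module.finrank ℚ F =
      ∑ P : GalT F, if (conjT : GalT F) ∈ Subgroup.zpowers P then 0 else 2 ^ (Module.finrank ℚ F / orderOf P / 2) := by
  rw [← FaceCensus.card_galT (F := F)]
  exact card_block_mul_card conjT conjT_mul_self (fun P => FaceBasis.conjT_comm P)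

/-- **The number of blocks of a CYCLIC Galois CM field**: `β(F)·[F:ℚ] = Σ_{d ∣ [F:ℚ], d odd} φ(d)·2^{[F:ℚ]/2/d}` — with §4, every
`hgen` face set of a cyclic CM field of degree `2m` has at least `(1/2m) Σ_{d | m, d odd} φ(d) 2^{m/d} − 1` members. [folklore] -/
theorem card_block_mul_finrank_of_isCyclic [IsCMField F] [IsGalois ℚ F] [IsCyclic (GalT F)] :
    Fintype.card (Block (conjT : GalT F)) * Module.finrank ℚ F =
      ∑ d ∈ (Module.finrank ℚ F).divisors with Odd d, Nat.totient d * 2 ^ (Module.finrank ℚ F / 2 / d) := by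
  rw [← FaceCensus.card_galT (F := F)]
  exact card_block_mul_card_of_isCyclic conjT conjT_mul_self conjT_ne_one

end Summit.HodgeConjecture.CorCM.FaceParity

end
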